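/- Width seat `ym-line-cbag-p1-w3` (prover-ym-line-cbag-p1-w3-g5-0), route `ColdBoxAllGroups` (planner-of-record ym-idea-2; cruxes
stmt-QuantumFields-22254 `BoxFloorAllGroups` / 22255 `BulkAllGroups` CLOSED proved): BULK at ALL small windows by a box-size transfer
(helper, `--supports stmt-QuantumFields-22255`). -/
import Summits.QuantumFields.YangMills.Theorems.ColdBoxAllGroupsXiPowExplicit
import Summits.QuantumFields.YangMills.Theorems.ColdBoxAllGroupsBoxFloorDimEPos

/-!
# BULK at EVERY small window `0 < A ≤ 1/4000`, `A < θ ≤ 1/100`, for every compact simple `G` — by a box-size transfer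

The proved BULK crux of the route (`BulkAllGroups_proof`, stmt-QuantumFields-22255) and its explicit twin
`bulkDominatesBox_allGroups_explicit` (`Theorems/ColdBoxAllGroupsXiPowExplicit.lean`) deliver `BulkDominatesBox r.ρ A θ` only along the
diagonal `A = θ/20` hard-wired in the DLR/chessboard bookkeeping (`eventually_kernelDatum_boundsG`: `δ = θ/5`, `A = θ/20`).  This file frees
the box exponent WITHOUT re-running that bookkeeping, by comparing the cold-wall box covariance at two box sizes through their common
Gaussian value:

1. `boxMaxwellPlaqCov_sandwich` — the free comb-gauge box kernel at depth `T = ⌈β^A⌉` in the box of half-side `H = ⌈β^θ⌉`, `A < θ`, is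
   two-sidedly comparable with the `ℤ⁴` curvature kernel: `½|C(T)| ≤ |Π_H(T)| ≤ 3/2·|C(T)|` for all large `β` (the upper half of S4
   `stub_boxKernelVsLattice`, same inputs: `exists_boxMaxwellPlaqCov_sub_bound`, `exists_curvaturePlaquetteCorr_asymp`).
2. `sq_mul_boxPlaqCov_le_of_rep` / `curvatureCorr_sq_le_sq_mul_boxPlaqCov_of_rep` — with the two-sided relative Gaussian domination
   `boxGaussianDomination_of_rep` (`|β²·boxPlaqCov − (D/4)·2Π²| ≤ (1/8)·2Π²`, every `0 < A < θ ≤ 1/100`, every faithful unitary `ρ`):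
   `(2D−1)/16 · C(T)² ≤ β²·boxPlaqCov ρ β ⌈β^θ⌉ ⌈β^A⌉ ≤ 9(2D+1)/16 · C(T)²`, `D = dimE ρ`.
3. `boxPlaqCov_le_of_windows` — hence for `0 < dimE ρ` and any two box exponents `θ, θ' ∈ (A, 1/100]`:
   `boxPlaqCov ρ β ⌈β^θ'⌉ ⌈β^A⌉ ≤ 27 · boxPlaqCov ρ β ⌈β^θ⌉ ⌈β^A⌉` for all large `β` (the cold-wall covariance at a fixed separation does not
   depend on the size of the cold box beyond a factor `27`, throughout the one-scale window).
4. `bulkDominatesBox_of_boxPlaqCov_le`, `bulkDominatesBox_rewindow_of_dimE_pos` — `BulkDominatesBox ρ A θ` transfers to every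
   `θ' ∈ (A, 1/100]` (the torus covariance dominates `η·boxPlaqCov_θ ≥ (η/27)·boxPlaqCov_θ'`).
5. **`bulkDominatesBox_allGroups_smallWindows`** — for every compact simple `G` (tree sense), every faithful unitary lattice representation
   `r`, and ALL `0 < A ≤ 1/4000`, `A < θ ≤ 1/100`: `BulkDominatesBox r.ρ A θ` (transfer from `θ = 20A`); with
   `boxTwoPointDomination_allGroups_explicit'` this is BOX ∧ BULK on every small window (`boxAndBulk_allGroups_smallWindows`).

Consequence for the sibling line `AllWindowsColdBox` (crux `BulkWindowSU2`, stmt-QuantumFields-23030, window `A < θ ≤ 7A`): its small-`A`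
half (`A ≤ 1/4000`) is settled by the `SU(2)` instance (`Theorems/AllWindowsColdBoxBulkWindowSU2SmallWindows.lean`); the open part of that
crux is `A > 1/4000` only.

No sorry; no new definition; standard axioms.  HONEST LABEL: finite-volume / torus weak-coupling covariance comparisons in the ONE-scale
window (RECORD-label rung level, R2xi-G `XiPow`, already proved); this is NOT the Yang–Mills mass gap and no summit statement is proved here.
-/

set_option autoImplicit false

noncomputable section

open MeasureTheory Filter Topology Real
open Literature.MathematicalPhysics.QuantumLattice
open Literature.MathematicalPhysics.QuantumFieldTheory
open Literature.MathematicalPhysics.QuantumFieldTheory.LatticeMaxwell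
open Summit.QuantumFields.YangMills.Theorems.WeakCouplingRates
open Summit.QuantumFields.YangMills.Theorems.FreeEnergyLogCoefficient (dimE)

namespace Summit.QuantumFields.YangMills.Theorems.ColdBoxAllGroups

/-! ## 1. The free box kernel is two-sidedly comparable with the `ℤ⁴` curvature kernel -/

/-- **Kernel sandwich.**  For `0 < A < θ` and all large `β`, with `T = ⌈β^A⌉`, `H = ⌈β^θ⌉`:
`½|C(T)| ≤ |Π_H(T)| ≤ 3/2·|C(T)|`, where `Π_H(T) = boxMaxwellPlaqCov H T` is the free comb-gauge box plaquette kernel and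
`C(T) = curvaturePlaquetteCorr 4 T` the `ℤ⁴` curvature kernel (`|Π_H(T) − C(T)| ≤ K/H⁴` for `T ≤ H/8`, `H ≥ 32`, and
`|C(T) − 1/(π²T⁴)| ≤ K_C/T⁵`; thresholds as in S4 `stub_boxKernelVsLattice`, whose lower half this restates with the explicit `½`). -/
theorem boxMaxwellPlaqCov_sandwich : ∀ A θ : ℝ, 0 < A → A < θ → ∃ β₀ : ℝ, ∀ β : ℝ, β₀ ≤ β →
    1 / 2 * |curvaturePlaquetteCorr (d := 4) (by norm_num) (⌈β ^ A⌉₊ : ℤ)| ≤ |boxMaxwellPlaqCov ⌈β ^ θ⌉₊ ⌈β ^ A⌉₊| ∧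
      |boxMaxwellPlaqCov ⌈β ^ θ⌉₊ ⌈β ^ A⌉₊| ≤ 3 / 2 * |curvaturePlaquetteCorr (d := 4) (by norm_num) (⌈β ^ A⌉₊ : ℤ)| := by
  intro A θ hA hAθ
  obtain ⟨K_E, hKE0, hE⟩ := exists_boxMaxwellPlaqCov_sub_bound
  obtain ⟨K_C, hKC0, hC⟩ := exists_curvaturePlaquetteCorr_asymp
  have hθ : 0 < θ := hA.trans hAθ
  have hθA : 0 < θ - A := by linarith
  -- the thresholds (as in `stub_boxKernelVsLattice`)
  set M : ℝ := 1 + 4 * π ^ 2 * K_E with hM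
  have hM0 : 0 ≤ 4 * π ^ 2 * K_E := by positivity
  have hM1 : 1 ≤ M := by linarith
  set L : ℝ := 2 * π ^ 2 * K_C + 1 with hL
  have hL0 : 0 ≤ 2 * π ^ 2 * K_C := by positivity
  have hL1 : 1 ≤ L := by linarith
  set β₀ : ℝ := max (max 1 ((32 : ℝ) ^ (1 / θ))) (max ((16 * M) ^ (1 / (θ - A))) (L ^ (1 / A))) with hβ₀
  refine ⟨β₀, fun β hβ => ?_⟩
  have hβ1 : 1 ≤ β := le_trans (le_trans (le_max_left _ _) (le_max_left _ _)) hβ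
  have hβ0 : 0 ≤ β := by linarith
  -- the powers of `β`
  have hθpow : (32 : ℝ) ≤ β ^ θ :=
    le_rpow_of_root_le (by norm_num) hθ (le_trans (le_trans (le_max_right _ _) (le_max_left _ _)) hβ)
  have hdiff : 16 * M ≤ β ^ (θ - A) :=
    le_rpow_of_root_le (by positivity) hθA (le_trans (le_trans (le_max_left _ _) (le_max_right _ _)) hβ)
  have hApow : L ≤ β ^ A :=
    le_rpow_of_root_le (by positivity) hA (le_trans (le_trans (le_max_right _ _) (le_max_right _ _)) hβ)
  have hA1 : 1 ≤ β ^ A := hL1.trans hApow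
  have hsplit : β ^ θ = β ^ (θ - A) * β ^ A := by
    rw [← Real.rpow_add (by linarith)]; ring_nf
  -- `T` and `H`
  set T : ℕ := ⌈β ^ A⌉₊ with hT
  set H : ℕ := ⌈β ^ θ⌉₊ with hH
  have hT_ge : β ^ A ≤ (T : ℝ) := Nat.le_ceil _
  have hT_lt : (T : ℝ) < β ^ A + 1 := Nat.ceil_lt_add_one (by positivity)
  have hT_le : (T : ℝ) ≤ 2 * β ^ A := by linarith
  have hH_ge : β ^ θ ≤ (H : ℝ) := Nat.le_ceil _
  have hT1 : 1 ≤ T := by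
    have : (1 : ℝ) ≤ T := hA1.trans hT_ge
    exact_mod_cast this
  have hT0 : (0 : ℝ) < T := by exact_mod_cast hT1
  have hH32 : (32 : ℝ) ≤ H := hθpow.trans hH_ge
  have hH0 : (0 : ℝ) < H := by linarith
  -- `H ≥ M · T` and `T ≤ H/8`
  have hHT : M * (T : ℝ) ≤ (H : ℝ) / 8 := by
    have h1 : M * (T : ℝ) ≤ M * (2 * β ^ A) := mul_le_mul_of_nonneg_left hT_le (by linarith)
    have h2 : 16 * M * β ^ A ≤ β ^ (θ - A) * β ^ A := mul_le_mul_of_nonneg_right hdiff (by linarith)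
    rw [← hsplit] at h2
    linarith
  have hTH : (T : ℝ) ≤ (H : ℝ) / 8 := by
    have : (T : ℝ) ≤ M * T := le_mul_of_one_le_left hT0.le hM1
    linarith
  -- `K_E / H⁴ ≤ (1/(4π²))/T⁴`
  have hEH : K_E / (H : ℝ) ^ 4 ≤ 1 / (4 * π ^ 2) / (T : ℝ) ^ 4 := by
    have hMT : M * (T : ℝ) ≤ H := by linarith
    have hMT4 : (M * (T : ℝ)) ^ 4 ≤ (H : ℝ) ^ 4 := pow_le_pow_left₀ (by positivity) hMT 4
    have hM4 : 4 * π ^ 2 * K_E ≤ M ^ 4 := by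
      have : M ≤ M ^ 4 := by
        calc M = M ^ 1 := (pow_one M).symm
          _ ≤ M ^ 4 := pow_le_pow_right₀ hM1 (by norm_num)
      linarith
    rw [div_le_div_iff₀ (by positivity) (by positivity)]
    calc K_E * (T : ℝ) ^ 4 = (4 * π ^ 2 * K_E) * (T : ℝ) ^ 4 * (1 / (4 * π ^ 2)) := by field_simp
      _ ≤ M ^ 4 * (T : ℝ) ^ 4 * (1 / (4 * π ^ 2)) := by gcongr
      _ = 1 / (4 * π ^ 2) * (M * (T : ℝ)) ^ 4 := by ring
      _ ≤ 1 / (4 * π ^ 2) * (H : ℝ) ^ 4 := mul_le_mul_of_nonneg_left hMT4 (by positivity)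
  -- `K_C / T⁵ ≤ (1/(2π²))/T⁴`
  have hCT : K_C / (T : ℝ) ^ 5 ≤ 1 / (2 * π ^ 2) / (T : ℝ) ^ 4 := by
    have hLT : L ≤ (T : ℝ) := hApow.trans hT_ge
    have hKT : 2 * π ^ 2 * K_C ≤ (T : ℝ) := by linarith
    rw [div_le_div_iff₀ (by positivity) (by positivity)]
    calc K_C * (T : ℝ) ^ 4 = (2 * π ^ 2 * K_C) * (T : ℝ) ^ 4 * (1 / (2 * π ^ 2)) := by field_simp
      _ ≤ (T : ℝ) * (T : ℝ) ^ 4 * (1 / (2 * π ^ 2)) := by gcongr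
      _ = 1 / (2 * π ^ 2) * (T : ℝ) ^ 5 := by ring
  -- the two kernel estimates at the central pair
  have hPC : |boxMaxwellPlaqCov H T - curvaturePlaquetteCorr (d := 4) (by norm_num) (T : ℤ)| ≤ K_E / (H : ℝ) ^ 4 :=
    hE H hH32 T hTH
  have hCa : |curvaturePlaquetteCorr (d := 4) (by norm_num) (T : ℤ) - 1 / π ^ 2 / (T : ℝ) ^ 4| ≤ K_C / (T : ℝ) ^ 5 := hC T hT1
  set P : ℝ := boxMaxwellPlaqCov H T with hP
  set Cc : ℝ := curvaturePlaquetteCorr (d := 4) (by norm_num) (T : ℤ) with hCc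
  -- `|C(T)| ≥ 1/(2π²T⁴)`, hence the kernel error is at most `|C(T)|/2`
  have hmain : 1 / π ^ 2 / (T : ℝ) ^ 4 = 2 * (1 / (2 * π ^ 2) / (T : ℝ) ^ 4) := by
    field_simp
  have hquarter : 1 / (4 * π ^ 2) / (T : ℝ) ^ 4 = 1 / 2 * (1 / (2 * π ^ 2) / (T : ℝ) ^ 4) := by
    ring
  have hClow : 1 / (2 * π ^ 2) / (T : ℝ) ^ 4 ≤ |Cc| := by
    have h1 : |1 / π ^ 2 / (T : ℝ) ^ 4| - |Cc| ≤ |Cc - 1 / π ^ 2 / (T : ℝ) ^ 4| := by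
      rw [abs_sub_comm]; exact abs_sub_abs_le_abs_sub _ _
    have h2 : |1 / π ^ 2 / (T : ℝ) ^ 4| = 1 / π ^ 2 / (T : ℝ) ^ 4 := abs_of_nonneg (by positivity)
    rw [h2] at h1
    linarith [hCa.trans hCT, hmain]
  have herr : |P - Cc| ≤ 1 / 2 * |Cc| := by
    calc |P - Cc| ≤ K_E / (H : ℝ) ^ 4 := hPC
      _ ≤ 1 / (4 * π ^ 2) / (T : ℝ) ^ 4 := hEH
      _ = 1 / 2 * (1 / (2 * π ^ 2) / (T : ℝ) ^ 4) := hquarter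
      _ ≤ 1 / 2 * |Cc| := by gcongr
  constructor
  · -- `|P| ≥ |C| − |P − C| ≥ |C|/2`
    have h := abs_sub_abs_le_abs_sub Cc P
    rw [abs_sub_comm] at h
    linarith
  · -- `|P| ≤ |C| + |P − C| ≤ 3/2 |C|`
    have h := abs_add_le (P - Cc) Cc
    rw [sub_add_cancel] at h
    linarith

/-! ## 2. Two-sided bounds of the cold-wall covariance in units of `C(T)²`, every faithful unitary `ρ` -/

section Rep

variable {N : ℕ} {G : Type} [Group G] [TopologicalSpace G] [IsTopologicalGroup G] [CompactSpace G]
  [MeasurableSpace G] [BorelSpace G] (ρ : G →* Matrix (Fin N) (Fin N) ℂ)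

/-- **Upper bound.**  For a faithful continuous unitary `ρ : G →* U(N)` (`G` compact, any Borel structure) and `0 < A < θ ≤ 1/100`:
eventually in `β`, `β²·boxPlaqCov ρ β ⌈β^θ⌉ ⌈β^A⌉ ≤ 9(2D+1)/16 · C(⌈β^A⌉)²`, `D = dimE ρ` (relative Gaussian domination
`boxGaussianDomination_of_rep` from above: `β²·boxPlaqCov ≤ (D/4 + 1/8)·2Π²`, and `Π² ≤ 9/4·C²` by the kernel sandwich). -/
theorem sq_mul_boxPlaqCov_le_of_rep (hρc : Continuous ρ) (hinj : Function.Injective ρ)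
    (hρu : ∀ g, ρ g ∈ Matrix.unitaryGroup (Fin N) ℂ) {A θ : ℝ} (hA : 0 < A) (hAθ : A < θ) (hθ1 : θ ≤ 1 / 100) :
    ∃ β₀ : ℝ, ∀ β : ℝ, β₀ ≤ β →
      β ^ 2 * boxPlaqCov ρ β ⌈β ^ θ⌉₊ ⌈β ^ A⌉₊ ≤
        9 * (2 * (dimE ρ : ℝ) + 1) / 16 * curvaturePlaquetteCorr (d := 4) (by norm_num) (⌈β ^ A⌉₊ : ℤ) ^ 2 := by
  obtain ⟨β₀, h₀⟩ := boxGaussianDomination_of_rep ρ hρc hinj hρu hA hAθ hθ1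
  obtain ⟨β₁, h₁⟩ := boxMaxwellPlaqCov_sandwich A θ hA hAθ
  refine ⟨max β₀ β₁, fun β hβ => ?_⟩
  have h0 := (abs_le.1 (h₀ β ((le_max_left _ _).trans hβ))).2
  have hhi := (h₁ β ((le_max_right _ _).trans hβ)).2
  have hW := stub_boxGaussianWick ⌈β ^ θ⌉₊ ⌈β ^ A⌉₊
  set P := boxMaxwellPlaqCov ⌈β ^ θ⌉₊ ⌈β ^ A⌉₊ with hP
  set S := boxCircSqCov ⌈β ^ θ⌉₊ ⌈β ^ A⌉₊ with hS
  set Cc := curvaturePlaquetteCorr (d := 4) (by norm_num) (⌈β ^ A⌉₊ : ℤ) with hCc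
  have hS2 : S = 2 * P ^ 2 := hW
  have hD0 : (0 : ℝ) ≤ (dimE ρ : ℝ) := Nat.cast_nonneg _
  have hP2 : P ^ 2 ≤ 9 / 4 * Cc ^ 2 := by
    have h := pow_le_pow_left₀ (abs_nonneg _) hhi 2
    rw [mul_pow, sq_abs, sq_abs] at h
    nlinarith [h]
  have hup : β ^ 2 * boxPlaqCov ρ β ⌈β ^ θ⌉₊ ⌈β ^ A⌉₊ ≤ ((dimE ρ : ℝ) / 4 + 1 / 8) * S := by linarith
  rw [hS2] at hup
  have hcoef : 0 ≤ (dimE ρ : ℝ) / 4 + 1 / 8 := by positivity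
  calc β ^ 2 * boxPlaqCov ρ β ⌈β ^ θ⌉₊ ⌈β ^ A⌉₊ ≤ ((dimE ρ : ℝ) / 4 + 1 / 8) * (2 * P ^ 2) := hup
    _ ≤ ((dimE ρ : ℝ) / 4 + 1 / 8) * (2 * (9 / 4 * Cc ^ 2)) := by gcongr
    _ = 9 * (2 * (dimE ρ : ℝ) + 1) / 16 * Cc ^ 2 := by ring

/-- **Lower bound.**  For a faithful continuous unitary `ρ : G →* U(N)` with `0 < dimE ρ` and `0 < A < θ ≤ 1/100`: eventually in `β`,
`(2D−1)/16 · C(⌈β^A⌉)² ≤ β²·boxPlaqCov ρ β ⌈β^θ⌉ ⌈β^A⌉` (relative Gaussian domination from below, `β²·boxPlaqCov ≥ (D/4 − 1/8)·2Π²`, and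
`Π² ≥ C²/4`); in particular `C²/16 ≤ β²·boxPlaqCov`.  (The BOX floor `boxTwoPointDomination_of_dimE_pos` with its constant exposed.) -/
theorem curvatureCorr_sq_le_sq_mul_boxPlaqCov_of_rep (hρc : Continuous ρ) (hinj : Function.Injective ρ)
    (hρu : ∀ g, ρ g ∈ Matrix.unitaryGroup (Fin N) ℂ) (hD : 0 < dimE ρ) {A θ : ℝ} (hA : 0 < A) (hAθ : A < θ)
    (hθ1 : θ ≤ 1 / 100) :
    ∃ β₀ : ℝ, ∀ β : ℝ, β₀ ≤ β →
      (2 * (dimE ρ : ℝ) - 1) / 16 * curvaturePlaquetteCorr (d := 4) (by norm_num) (⌈β ^ A⌉₊ : ℤ) ^ 2 ≤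
        β ^ 2 * boxPlaqCov ρ β ⌈β ^ θ⌉₊ ⌈β ^ A⌉₊ := by
  obtain ⟨β₀, h₀⟩ := boxGaussianDomination_of_rep ρ hρc hinj hρu hA hAθ hθ1
  obtain ⟨β₁, h₁⟩ := boxMaxwellPlaqCov_sandwich A θ hA hAθ
  refine ⟨max β₀ β₁, fun β hβ => ?_⟩
  have h0 := (abs_le.1 (h₀ β ((le_max_left _ _).trans hβ))).1
  have hlo := (h₁ β ((le_max_right _ _).trans hβ)).1
  have hW := stub_boxGaussianWick ⌈β ^ θ⌉₊ ⌈β ^ A⌉₊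
  set P := boxMaxwellPlaqCov ⌈β ^ θ⌉₊ ⌈β ^ A⌉₊ with hP
  set S := boxCircSqCov ⌈β ^ θ⌉₊ ⌈β ^ A⌉₊ with hS
  set Cc := curvaturePlaquetteCorr (d := 4) (by norm_num) (⌈β ^ A⌉₊ : ℤ) with hCc
  have hS2 : S = 2 * P ^ 2 := hW
  have hD1 : (1 : ℝ) ≤ (dimE ρ : ℝ) := by exact_mod_cast Nat.succ_le_of_lt hD
  have hP2 : 1 / 4 * Cc ^ 2 ≤ P ^ 2 := by
    have h := pow_le_pow_left₀ (by positivity) hlo 2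
    rw [mul_pow, sq_abs, sq_abs] at h
    nlinarith [h]
  have hlow : ((dimE ρ : ℝ) / 4 - 1 / 8) * S ≤ β ^ 2 * boxPlaqCov ρ β ⌈β ^ θ⌉₊ ⌈β ^ A⌉₊ := by linarith
  rw [hS2] at hlow
  have hcoef : 0 ≤ (dimE ρ : ℝ) / 4 - 1 / 8 := by linarith
  calc (2 * (dimE ρ : ℝ) - 1) / 16 * Cc ^ 2 = ((dimE ρ : ℝ) / 4 - 1 / 8) * (2 * (1 / 4 * Cc ^ 2)) := by ring
    _ ≤ ((dimE ρ : ℝ) / 4 - 1 / 8) * (2 * P ^ 2) := by gcongr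
    _ ≤ _ := hlow

/-- **The cold-wall covariance at a fixed separation is insensitive to the size of the cold box, up to a factor `27`, throughout the
one-scale window.**  For a faithful continuous unitary `ρ : G →* U(N)` with `0 < dimE ρ`, `0 < A`, and any two box exponents
`θ, θ' ∈ (A, 1/100]`: for all large `β`, `boxPlaqCov ρ β ⌈β^θ'⌉ ⌈β^A⌉ ≤ 27 · boxPlaqCov ρ β ⌈β^θ⌉ ⌈β^A⌉`
(`9(2D+1) ≤ 27(2D−1)` for `D ≥ 1`).  Symmetric in `θ, θ'`, so the two covariances are comparable within `[1/27, 27]`. -/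
theorem boxPlaqCov_le_of_windows (hρc : Continuous ρ) (hinj : Function.Injective ρ)
    (hρu : ∀ g, ρ g ∈ Matrix.unitaryGroup (Fin N) ℂ) (hD : 0 < dimE ρ) {A θ θ' : ℝ} (hA : 0 < A) (hAθ : A < θ)
    (hθ1 : θ ≤ 1 / 100) (hAθ' : A < θ') (hθ'1 : θ' ≤ 1 / 100) :
    ∃ β₀ : ℝ, ∀ β : ℝ, β₀ ≤ β →
      boxPlaqCov ρ β ⌈β ^ θ'⌉₊ ⌈β ^ A⌉₊ ≤ 27 * boxPlaqCov ρ β ⌈β ^ θ⌉₊ ⌈β ^ A⌉₊ := by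
  obtain ⟨β₀, h₀⟩ := curvatureCorr_sq_le_sq_mul_boxPlaqCov_of_rep ρ hρc hinj hρu hD hA hAθ hθ1
  obtain ⟨β₁, h₁⟩ := sq_mul_boxPlaqCov_le_of_rep ρ hρc hinj hρu hA hAθ' hθ'1
  refine ⟨max (max β₀ β₁) 1, fun β hβ => ?_⟩
  have hβ1 : 1 ≤ β := (le_max_right _ _).trans hβ
  have hβ2 : 0 < β ^ 2 := by positivity
  have hlo := h₀ β (((le_max_left _ _).trans (le_max_left _ _)).trans hβ)
  have hhi := h₁ β (((le_max_right _ _).trans (le_max_left _ _)).trans hβ)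
  have hD1 : (1 : ℝ) ≤ (dimE ρ : ℝ) := by exact_mod_cast Nat.succ_le_of_lt hD
  set Cc := curvaturePlaquetteCorr (d := 4) (by norm_num) (⌈β ^ A⌉₊ : ℤ) with hCc
  have hC2 : 0 ≤ Cc ^ 2 := sq_nonneg _
  have hcoef : 9 * (2 * (dimE ρ : ℝ) + 1) / 16 ≤ 27 * ((2 * (dimE ρ : ℝ) - 1) / 16) := by linarith
  have key : β ^ 2 * boxPlaqCov ρ β ⌈β ^ θ'⌉₊ ⌈β ^ A⌉₊ ≤ β ^ 2 * (27 * boxPlaqCov ρ β ⌈β ^ θ⌉₊ ⌈β ^ A⌉₊) := by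
    calc β ^ 2 * boxPlaqCov ρ β ⌈β ^ θ'⌉₊ ⌈β ^ A⌉₊ ≤ 9 * (2 * (dimE ρ : ℝ) + 1) / 16 * Cc ^ 2 := hhi
      _ ≤ 27 * ((2 * (dimE ρ : ℝ) - 1) / 16) * Cc ^ 2 := mul_le_mul_of_nonneg_right hcoef hC2
      _ = 27 * ((2 * (dimE ρ : ℝ) - 1) / 16 * Cc ^ 2) := by ring
      _ ≤ 27 * (β ^ 2 * boxPlaqCov ρ β ⌈β ^ θ⌉₊ ⌈β ^ A⌉₊) := by gcongr
      _ = β ^ 2 * (27 * boxPlaqCov ρ β ⌈β ^ θ⌉₊ ⌈β ^ A⌉₊) := by ring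
  exact le_of_mul_le_mul_left key hβ2

/-! ## 3. BULK transfers between box exponents -/

/-- **BULK transfer along a covariance comparison** (pure bookkeeping on `BulkDominatesBox`): if eventually
`boxPlaqCov_θ'(⌈β^A⌉) ≤ K·boxPlaqCov_θ(⌈β^A⌉)` with `K > 0`, then `BulkDominatesBox ρ A θ → BulkDominatesBox ρ A θ'` (with `η/K`). -/
theorem bulkDominatesBox_of_boxPlaqCov_le {A θ θ' K : ℝ} (hK : 0 < K)
    (hcmp : ∃ β₀ : ℝ, ∀ β : ℝ, β₀ ≤ β →
      boxPlaqCov ρ β ⌈β ^ θ'⌉₊ ⌈β ^ A⌉₊ ≤ K * boxPlaqCov ρ β ⌈β ^ θ⌉₊ ⌈β ^ A⌉₊)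
    (h : BulkDominatesBox ρ A θ) : BulkDominatesBox ρ A θ' := by
  obtain ⟨η, hη, β₁, h⟩ := h
  obtain ⟨β₀, hcmp⟩ := hcmp
  refine ⟨η / K, div_pos hη hK, max β₀ β₁, fun β hβ => ?_⟩
  filter_upwards [h β ((le_max_right _ _).trans hβ)] with L hL
  have hc := hcmp β ((le_max_left _ _).trans hβ)
  have hηK : 0 ≤ η / K := (div_pos hη hK).le
  calc η / K * boxPlaqCov ρ β ⌈β ^ θ'⌉₊ ⌈β ^ A⌉₊ ≤ η / K * (K * boxPlaqCov ρ β ⌈β ^ θ⌉₊ ⌈β ^ A⌉₊) :=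
        mul_le_mul_of_nonneg_left hc hηK
    _ = η * boxPlaqCov ρ β ⌈β ^ θ⌉₊ ⌈β ^ A⌉₊ := by field_simp
    _ ≤ _ := hL

/-- **Re-windowing BULK in the one-scale window, every compact `G` with `0 < dimE ρ`.**  If the torus dominates the cold box of exponent
`θ ∈ (A, 1/100]` at separation `⌈β^A⌉` (`BulkDominatesBox ρ A θ`), it dominates the cold box of every other exponent `θ' ∈ (A, 1/100]`
(`boxPlaqCov_le_of_windows` + `bulkDominatesBox_of_boxPlaqCov_le`). -/
theorem bulkDominatesBox_rewindow_of_dimE_pos (hρc : Continuous ρ) (hinj : Function.Injective ρ)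
    (hρu : ∀ g, ρ g ∈ Matrix.unitaryGroup (Fin N) ℂ) (hD : 0 < dimE ρ) {A θ θ' : ℝ} (hA : 0 < A) (hAθ : A < θ)
    (hθ1 : θ ≤ 1 / 100) (hAθ' : A < θ') (hθ'1 : θ' ≤ 1 / 100) (h : BulkDominatesBox ρ A θ) :
    BulkDominatesBox ρ A θ' :=
  bulkDominatesBox_of_boxPlaqCov_le ρ (by norm_num : (0 : ℝ) < 27)
    (boxPlaqCov_le_of_windows ρ hρc hinj hρu hD hA hAθ hθ1 hAθ' hθ'1) h

end Rep

/-! ## 4. BULK (and BOX ∧ BULK) at every small window, every compact simple `G` -/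

/-- **BULK_G at EVERY small window.**  For every compact simple `G` (tree sense, any Borel measurable structure), every faithful unitary
lattice representation `r`, and ALL exponents `0 < A ≤ 1/4000`, `A < θ ≤ 1/100`: `BulkDominatesBox r.ρ A θ` — some `η > 0` such that for all
large `β`, eventually in the torus size `L`, the torus covariance of the `(1,2)`-plaquette cost and its translate by `⌈β^A⌉e₀` is
`≥ η ×` the same covariance in the cold-wall box of half-side `⌈β^θ⌉`.  (`bulkDominatesBox_allGroups_explicit` at `θ = 20A ≤ 1/200`,
re-windowed by `bulkDominatesBox_rewindow_of_dimE_pos`; `0 < dimE r.ρ` by `dimE_pos_of_isCompactSimpleLieGroup`.)  NOT the Clay gap. -/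
theorem bulkDominatesBox_allGroups_smallWindows
    (G : Type) [Group G] [TopologicalSpace G] [IsTopologicalGroup G] [CompactSpace G] [MeasurableSpace G] [BorelSpace G]
    (hG : IsCompactSimpleLieGroup G) (r : LatticeRep G) {A θ : ℝ} (hA : 0 < A) (hA1 : A ≤ 1 / 4000) (hAθ : A < θ)
    (hθ1 : θ ≤ 1 / 100) : BulkDominatesBox r.ρ A θ := by
  have hD : 0 < dimE r.ρ :=
    Summit.QuantumFields.YangMills.Cruxes.NT.LinkEquipartition.dimE_pos_of_isCompactSimpleLieGroup G r hG
  have hbig : BulkDominatesBox r.ρ (20 * A / 20) (20 * A) :=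
    bulkDominatesBox_allGroups_explicit G hG r (θ := 20 * A) (by positivity) (by linarith)
  rw [show 20 * A / 20 = A by ring] at hbig
  exact bulkDominatesBox_rewindow_of_dimE_pos r.ρ r.continuous r.injective r.mem_unitary hD hA
    (by linarith : A < 20 * A) (by linarith : 20 * A ≤ 1 / 100) hAθ hθ1 hbig

/-- **BOX ∧ BULK at EVERY small window, every compact simple `G`:** for all `0 < A ≤ 1/4000` and `A < θ ≤ 1/100`,
`(∃ c > 0, BoxTwoPointDomination r.ρ A θ c) ∧ BulkDominatesBox r.ρ A θ` (BOX by the universal ceiling `boxTwoPointDomination_allGroups_explicit'`).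
Through `massGapPowerDecayOf_of_box` each such window re-proves the rung `MassGapPowerDecayOf 4 r.ρ (A/2)` (nothing beyond
`xiPow_uniform`).  NOT the Clay gap. -/
theorem boxAndBulk_allGroups_smallWindows
    (G : Type) [Group G] [TopologicalSpace G] [IsTopologicalGroup G] [CompactSpace G] [MeasurableSpace G] [BorelSpace G]
    (hG : IsCompactSimpleLieGroup G) (r : LatticeRep G) {A θ : ℝ} (hA : 0 < A) (hA1 : A ≤ 1 / 4000) (hAθ : A < θ)
    (hθ1 : θ ≤ 1 / 100) :
    (∃ c : ℝ, 0 < c ∧ BoxTwoPointDomination r.ρ A θ c) ∧ BulkDominatesBox r.ρ A θ :=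
  ⟨boxTwoPointDomination_allGroups_explicit' G hG r A θ hA hAθ hθ1,
    bulkDominatesBox_allGroups_smallWindows G hG r hA hA1 hAθ hθ1⟩

/-- **Display-binder form** (the route's `letI := borel G` convention of `Theses.ColdBoxAllGroups.BulkAllGroups`): for every compact simple
`G`, every `r`, all `0 < A ≤ 1/4000` and `A < θ ≤ 1/100`, `BulkDominatesBox r.ρ A θ`.  Compare the crux `BulkAllGroups`
(`∀ θ₀ > 0, ∃ 0 < A < θ ≤ θ₀, BulkDominatesBox r.ρ A θ`): here BOTH exponents range over a whole window.  NOT the Clay gap. -/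
theorem bulkDominatesBox_allGroups_smallWindows_borel :
    ∀ (G : Type) [Group G] [TopologicalSpace G] [IsTopologicalGroup G] [CompactSpace G],
    IsCompactSimpleLieGroup G →
    letI : MeasurableSpace G := borel G
    haveI : BorelSpace G := ⟨rfl⟩
    ∀ r : LatticeRep G, ∀ A θ : ℝ, 0 < A → A ≤ 1 / 4000 → A < θ → θ ≤ 1 / 100 → BulkDominatesBox r.ρ A θ := by
  intro G _ _ _ _ hG
  letI : MeasurableSpace G := borel G
  haveI : BorelSpace G := ⟨rfl⟩
  intro r A θ hA hA1 hAθ hθ1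
  exact bulkDominatesBox_allGroups_smallWindows G hG r hA hA1 hAθ hθ1

/-! ## 5. Appended 2026-08-28 (same seat): PW-CORR-POLY at EVERY small exponent

With BOX ∧ BULK available at every small window, the route's glue `polySeparationPlaquetteFloor_of_box` (BOX ∧ BULK ∧ FLOOR ⇒
PW-CORR-POLY) yields the volume-uniform torus floor at EVERY separation exponent `0 < A ≤ 1/4000` — compare
`torusPlaquetteFloor_allGroups_ceiling` (`Theorems/ColdBoxAllGroupsTorusPlaquetteFloor.lean`: SOME `A` below each ceiling). -/

/-- **PW-CORR-POLY(A) for EVERY `0 < A ≤ 1/4000`, every compact simple `G`, every `r`:** there is `κ > 0` with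
`PolySeparationPlaquetteFloor 4 r.ρ 1 2 A κ` — for `β ≥ β₀`, eventually in the torus size `L`, the torus covariance of the `(1,2)`-plaquette
cost and its translate by `⌈β^A⌉e₀` is `≥ κ·β^{−(2+8A)}` (BOX and BULK at the window `(A, 2A)`, FLOOR `curvatureCorrPowerFloor_proof`).  The
hypothesis H of `SteinBlockTransferG_of_polySeparationFloorAllG` at a PRESCRIBED exponent.  NOT the Clay gap. -/
theorem torusPlaquetteFloor_allGroups_smallExponents
    (G : Type) [Group G] [TopologicalSpace G] [IsTopologicalGroup G] [CompactSpace G] [MeasurableSpace G] [BorelSpace G]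
    (hG : IsCompactSimpleLieGroup G) (r : LatticeRep G) {A : ℝ} (hA : 0 < A) (hA1 : A ≤ 1 / 4000) :
    ∃ κ : ℝ, 0 < κ ∧ PolySeparationPlaquetteFloor 4 r.ρ 1 2 A κ := by
  obtain ⟨c, hc, hbox⟩ := boxTwoPointDomination_allGroups_explicit' G hG r A (2 * A) hA (by linarith) (by linarith)
  exact polySeparationPlaquetteFloor_of_box r.ρ hA hc hbox
    (bulkDominatesBox_allGroups_smallWindows G hG r hA hA1 (by linarith : A < 2 * A) (by linarith)) curvatureCorrPowerFloor_proof

/-- **PW-CORR-POLY(A) at a prescribed exponent without simplicity**: for every compact `G` (any Borel structure), every faithful unitary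
lattice representation `r` with `0 < dimE r.ρ` and `0 < A ≤ 1/200`, given BULK for `r.ρ` at the window `(A, 2A)` (supplied for `A ≤ 1/4000` by
`bulkDominatesBox_smallWindows_of_dimE_pos`, `Theorems/ColdBoxAllGroupsXiPowDimEPosExplicit.lean`), `∃ κ > 0, PolySeparationPlaquetteFloor 4 r.ρ 1 2 A κ`
(BOX from `boxTwoPointDomination_of_dimE_pos`).  NOT the Clay gap. -/
theorem torusPlaquetteFloor_smallExponents_of_dimE_pos
    (G : Type) [Group G] [TopologicalSpace G] [IsTopologicalGroup G] [CompactSpace G] [MeasurableSpace G] [BorelSpace G]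
    (r : LatticeRep G) (hD : 0 < dimE r.ρ) {A : ℝ} (hA : 0 < A) (hA1 : A ≤ 1 / 200)
    (hbulk : BulkDominatesBox r.ρ A (2 * A)) :
    ∃ κ : ℝ, 0 < κ ∧ PolySeparationPlaquetteFloor 4 r.ρ 1 2 A κ := by
  obtain ⟨c, hc, hbox⟩ := boxTwoPointDomination_of_dimE_pos r.ρ r.continuous r.injective r.mem_unitary hD hA
    (by linarith : A < 2 * A) (by linarith : 2 * A ≤ 1 / 100)
  exact polySeparationPlaquetteFloor_of_box r.ρ hA hc hbox hbulk curvatureCorrPowerFloor_proof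

end Summit.QuantumFields.YangMills.Theorems.ColdBoxAllGroups

end
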